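import Literature.NumberTheory.LFunctions.RudnickSarnakNCoefficients
import Mathlib.Algebra.Order.Antidiag.Nat
import Mathlib.MeasureTheory.Integral.Pi
import HarnessLib

/-!
# Rudnick–Sarnak `n`-level correlations for `ζ`, VI: tuple expansions and the exchange of the
slice integral with the sum over prime tuples

Sibling file of `Literature/NumberTheory/LFunctions/RudnickSarnak.lean` (toward
`Literature.NumberTheory.LFunctions.rudnick_sarnak_unrestricted` at every level). Generic
bookkeeping used in the diagonal analysis (Rudnick–Sarnak 1996, §3, (3.33)–(3.36): the terms
`C_{r,s}(T) = Σ_{n} c(n_1)⋯c(n_r) conj(c(n_{r+1})⋯c(n_{r+s})) (n_1⋯n_{r+s})^{−1/2} A_{r,s}(n, T)`,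
i.e. "first sum over the tuples `n`, then integrate over `ξ`"):

* the **tuple expansion** of an iterated Dirichlet product,
  `(Π_{i<r} f_i)(m) = Σ_{ν ∈ finMulAntidiag r m} Π_i f_i(ν_i)`
  (`ArithmeticFunction.prod_apply_eq_sum_finMulAntidiag`);
* **regrouping** a sum over `m` and `ν ∈ finMulAntidiag r m` as a sum over all tuples
  `ν ∈ [1, N]^r` (`RudnickSarnakN.sum_Icc_sum_finMulAntidiag_eq`, `RudnickSarnakN.sum_piFinset_ite_prod_eq`);
* the **exchange lemma** on the slice `ξ_0 = −Σ η`: for non-negative single-coordinate factors,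
  `∫_{ℝ^k} Π_j h_j(ξ_j(η)) dη ≤ (sup h_0) Π_{i<k} ∫ h_{i+1}` (`RudnickSarnakN.integral_prod_cons_le`);
* the one-dimensional integrals of the factors: `∫ g₀(L|x|) dx = κ(0)/L` and
  `∫ c_{L|x|}(ν) dx ≤ 2κ(0) Λ(ν)/(L√ν)`, with equality for `ν ≥ 2`
  (`RudnickSarnakN.integral_g0_re_mul_abs`, `RudnickSarnakN.integral_coefR_mul_abs_le`,
  `RudnickSarnakN.integral_coefR_mul_abs_eq`).

## References

* Z. Rudnick, P. Sarnak, *Zeros of principal `L`-functions and random matrix theory*, Duke Math.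
  J. 81 (1996), 269–322, §3, (3.33)–(3.36).
-/

noncomputable section

open Complex Filter Set MeasureTheory Finset
open MeasureTheory.Measure (integral_comp_mul_left)
open scoped Real Topology ArithmeticFunction.vonMangoldt

/-! ## Tuple expansion of iterated Dirichlet products -/

namespace ArithmeticFunction

variable {R : Type*} [CommSemiring R]

/-- **Tuple expansion**: `(Π_{i : Fin r} f_i)(m) = Σ_{ν ∈ finMulAntidiag r m} Π_i f_i(ν_i)`
(the `r`-fold Dirichlet product summed over ordered factorisations `m = ν_0 ⋯ ν_{r−1}`).
[folklore] -/
theorem prod_apply_eq_sum_finMulAntidiag {r : ℕ} (f : Fin r → ArithmeticFunction R) (m : ℕ) :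
    (∏ i, f i) m = ∑ ν ∈ Nat.finMulAntidiag r m, ∏ i, f i (ν i) := by
  induction r generalizing m with
  | zero =>
    by_cases hm : m = 1
    · subst hm
      simp [Nat.finMulAntidiag_one]
    · rw [Nat.finMulAntidiag_zero_left hm, Finset.sum_empty, Finset.univ_eq_empty, Finset.prod_empty, one_apply,
        if_neg hm]
  | succ r ih =>
    rw [Fin.prod_univ_succ, mul_apply]
    simp_rw [ih (fun i ↦ f i.succ), Finset.mul_sum]
    rw [Finset.sum_sigma']
    symm
    refine Finset.sum_nbij' (fun ν ↦ ⟨(ν 0, ∏ i : Fin r, ν i.succ), Fin.tail ν⟩)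
      (fun x ↦ Fin.cons x.1.1 x.2) ?_ ?_ ?_ ?_ ?_
    · intro ν hν
      rw [Nat.mem_finMulAntidiag] at hν
      obtain ⟨hprod, hm⟩ := hν
      rw [Fin.prod_univ_succ] at hprod
      simp only [Finset.mem_sigma, Nat.mem_divisorsAntidiagonal, Nat.mem_finMulAntidiag]
      refine ⟨⟨hprod, hm⟩, ?_, ?_⟩
      · rfl
      · intro h0
        rw [h0, mul_zero] at hprod
        exact hm hprod.symm
    · rintro ⟨⟨d, e⟩, ν'⟩ hx
      simp only [Finset.mem_sigma, Nat.mem_divisorsAntidiagonal, Nat.mem_finMulAntidiag] at hx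
      obtain ⟨⟨hde, hm⟩, hν', he⟩ := hx
      rw [Nat.mem_finMulAntidiag, Fin.prod_univ_succ]
      simp only [Fin.cons_zero, Fin.cons_succ]
      exact ⟨by rw [hν', hde], hm⟩
    · intro ν _
      exact Fin.cons_self_tail ν
    · rintro ⟨⟨d, e⟩, ν'⟩ hx
      simp only [Finset.mem_sigma, Nat.mem_divisorsAntidiagonal, Nat.mem_finMulAntidiag] at hx
      obtain ⟨-, hν', -⟩ := hx
      simp only [Fin.cons_zero, Fin.cons_succ, Fin.tail_cons]
      rw [hν']
    · intro ν _
      simp only [Fin.prod_univ_succ]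
      rfl

end ArithmeticFunction

namespace Literature.NumberTheory.LFunctions

namespace RudnickSarnakN

/-! ## Regrouping sums over `finMulAntidiag` -/

/-- **Regrouping**: if `K(m, ν) = 0` whenever some `ν_i > N`, and `N^r ≤ B`, then
`Σ_{m=1}^{B} Σ_{ν ∈ finMulAntidiag r m} K(m, ν) = Σ_{ν ∈ [1,N]^r} K(Π ν, ν)`. [folklore] -/
theorem sum_Icc_sum_finMulAntidiag_eq {β : Type*} [AddCommMonoid β] {r N B : ℕ} (hB : N ^ r ≤ B)
    (K : ℕ → (Fin r → ℕ) → β) (hK : ∀ m ν, (∃ i, N < ν i) → K m ν = 0) :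
    ∑ m ∈ Finset.Icc 1 B, ∑ ν ∈ Nat.finMulAntidiag r m, K m ν =
      ∑ ν ∈ Fintype.piFinset (fun _ : Fin r ↦ Finset.Icc 1 N), K (∏ i, ν i) ν := by
  classical
  rw [Finset.sum_sigma']
  -- drop the tuples with a large entry
  rw [← Finset.sum_filter_of_ne (p := fun x : (Σ _ : ℕ, Fin r → ℕ) ↦ ∀ i, x.2 i ≤ N)]
  swap
  · rintro ⟨m, ν⟩ _ hne
    by_contra h
    push Not at h
    exact hne (hK m ν h)
  refine Finset.sum_nbij' (fun x ↦ x.2) (fun ν ↦ ⟨∏ i, ν i, ν⟩) ?_ ?_ ?_ ?_ ?_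
  · rintro ⟨m, ν⟩ hx
    simp only [Finset.mem_filter, Finset.mem_sigma, Finset.mem_Icc, Nat.mem_finMulAntidiag] at hx
    obtain ⟨⟨⟨hm1, hmB⟩, hprod, hm0⟩, hle⟩ := hx
    simp only [Fintype.mem_piFinset, Finset.mem_Icc]
    intro i
    refine ⟨Nat.one_le_iff_ne_zero.2 fun h ↦ ?_, hle i⟩
    rw [Finset.prod_eq_zero (Finset.mem_univ i) h] at hprod
    exact hm0 hprod.symm
  · intro ν hν
    simp only [Fintype.mem_piFinset, Finset.mem_Icc] at hν
    simp only [Finset.mem_filter, Finset.mem_sigma, Finset.mem_Icc, Nat.mem_finMulAntidiag]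
    have hpos : 0 < ∏ i, ν i := Finset.prod_pos fun i _ ↦ (hν i).1
    refine ⟨⟨⟨hpos, ?_⟩, trivial, hpos.ne'⟩, fun i ↦ (hν i).2⟩
    calc ∏ i, ν i ≤ ∏ _i : Fin r, N := Finset.prod_le_prod' fun i _ ↦ (hν i).2
      _ = N ^ r := by simp
      _ ≤ B := hB
  · rintro ⟨m, ν⟩ hx
    simp only [Finset.mem_filter, Finset.mem_sigma, Nat.mem_finMulAntidiag] at hx
    obtain ⟨⟨-, hprod, -⟩, -⟩ := hx
    simp only [hprod]
  · intro ν _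
    rfl
  · rintro ⟨m, ν⟩ hx
    simp only [Finset.mem_filter, Finset.mem_sigma, Nat.mem_finMulAntidiag] at hx
    obtain ⟨⟨-, hprod, -⟩, -⟩ := hx
    simp only [hprod]

/-- The tuples in `[1,N]^s` with product `P` are `finMulAntidiag s P` when the summand vanishes on
large entries: `Σ_{μ ∈ [1,N]^s, Π μ = P} G(μ) = Σ_{μ ∈ finMulAntidiag s P} G(μ)` for `P ≠ 0`.
[folklore] -/
theorem sum_piFinset_ite_prod_eq {β : Type*} [AddCommMonoid β] {s N P : ℕ} (hP : P ≠ 0)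
    (G : (Fin s → ℕ) → β) (hG : ∀ μ, (∃ j, N < μ j) → G μ = 0) :
    ∑ μ ∈ Fintype.piFinset (fun _ : Fin s ↦ Finset.Icc 1 N), (if ∏ j, μ j = P then G μ else 0) =
      ∑ μ ∈ Nat.finMulAntidiag s P, G μ := by
  classical
  rw [← Finset.sum_filter]
  rw [← Finset.sum_filter_of_ne (s := Nat.finMulAntidiag s P) (p := fun μ : Fin s → ℕ ↦ ∀ j, μ j ≤ N)]
  swap
  · intro μ _ hne
    by_contra h
    push Not at h
    exact hne (hG μ h)
  refine Finset.sum_congr ?_ fun _ _ ↦ rfl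
  ext μ
  simp only [Finset.mem_filter, Fintype.mem_piFinset, Finset.mem_Icc, Nat.mem_finMulAntidiag]
  constructor
  · rintro ⟨h, hprod⟩
    exact ⟨⟨hprod, hP⟩, fun j ↦ (h j).2⟩
  · rintro ⟨⟨hprod, -⟩, hle⟩
    refine ⟨fun j ↦ ⟨Nat.one_le_iff_ne_zero.2 fun h ↦ ?_, hle j⟩, hprod⟩
    rw [Finset.prod_eq_zero (Finset.mem_univ j) h] at hprod
    exact hP hprod.symm

/-- **Pair regrouping**: for summands vanishing on large entries and `N^r, N^s ≤ B`,
`Σ_{m=1}^{B} (Σ_{ν ∈ fMA r m} F ν)(Σ_{μ ∈ fMA s m} G μ) = Σ_{ν ∈ [1,N]^r} Σ_{μ ∈ [1,N]^s} [Πν = Πμ] F(ν) G(μ)`.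
[folklore] -/
theorem sum_Icc_sum_mul_sum_eq {r s N B : ℕ} (hB : N ^ r ≤ B) (F : (Fin r → ℕ) → ℝ) (G : (Fin s → ℕ) → ℝ)
    (hF : ∀ ν, (∃ i, N < ν i) → F ν = 0) (hG : ∀ μ, (∃ j, N < μ j) → G μ = 0) :
    ∑ m ∈ Finset.Icc 1 B, (∑ ν ∈ Nat.finMulAntidiag r m, F ν) * (∑ μ ∈ Nat.finMulAntidiag s m, G μ) =
      ∑ ν ∈ Fintype.piFinset (fun _ : Fin r ↦ Finset.Icc 1 N),
        ∑ μ ∈ Fintype.piFinset (fun _ : Fin s ↦ Finset.Icc 1 N),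
          (if ∏ i, ν i = ∏ j, μ j then F ν * G μ else 0) := by
  have h1 : ∀ m ∈ Finset.Icc 1 B, (∑ ν ∈ Nat.finMulAntidiag r m, F ν) * (∑ μ ∈ Nat.finMulAntidiag s m, G μ) =
      ∑ ν ∈ Nat.finMulAntidiag r m, F ν * ∑ μ ∈ Nat.finMulAntidiag s m, G μ := fun m _ ↦ Finset.sum_mul _ _ _
  rw [Finset.sum_congr rfl h1,
    sum_Icc_sum_finMulAntidiag_eq hB (fun m ν ↦ F ν * ∑ μ ∈ Nat.finMulAntidiag s m, G μ)
      (fun m ν h ↦ by rw [hF ν h, zero_mul])]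
  refine Finset.sum_congr rfl fun ν hν ↦ ?_
  have hP : ∏ i, ν i ≠ 0 := by
    simp only [Fintype.mem_piFinset, Finset.mem_Icc] at hν
    exact (Finset.prod_pos fun i _ ↦ (hν i).1).ne'
  have e : ∀ μ : Fin s → ℕ, (if ∏ i, ν i = ∏ j, μ j then F ν * G μ else 0) =
      F ν * (if ∏ j, μ j = ∏ i, ν i then G μ else 0) := by
    intro μ
    by_cases h : ∏ i, ν i = ∏ j, μ j
    · rw [if_pos h, if_pos h.symm]
    · rw [if_neg h, if_neg (Ne.symm h), mul_zero]
  simp_rw [e]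
  rw [← Finset.mul_sum, sum_piFinset_ite_prod_eq hP G hG]

/-! ## The exchange lemma on the slice -/

/-- **Exchange lemma** (slice form): for non-negative functions `h_j` of one variable with `h_0 ≤ B`
and `h_{i+1}` integrable, the integral over the slice `ξ_0 = −Σ η` of `Π_j h_j(ξ_j)` is at most
`B Π_{i<k} ∫ h_{i+1}` (bound the factor of the dependent coordinate by its supremum, then Fubini).
(Rudnick–Sarnak 1996, (3.36): "`A_{r,s}(n,T) = T^n ∫ Π g_j(⋯) Φ(ξ) δ(ξ_1+⋯+ξ_n) dξ`" is estimated
factor by factor.) [cite: RudnickSarnak1996, (3.36)] -/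
theorem integral_prod_cons_le {k : ℕ} (h : Fin (k + 1) → ℝ → ℝ) (h0 : ∀ j x, 0 ≤ h j x)
    (hint : ∀ i : Fin k, Integrable (h i.succ)) {B : ℝ} (hB : ∀ x, h 0 x ≤ B) :
    ∫ η : Fin k → ℝ, ∏ j, h j ((Fin.cons (-∑ i, η i) η : Fin (k + 1) → ℝ) j) ≤
      B * ∏ i : Fin k, ∫ x, h i.succ x := by
  have hB0 : 0 ≤ B := (h0 0 0).trans (hB 0)
  have hpt : ∀ η : Fin k → ℝ, ∏ j, h j ((Fin.cons (-∑ i, η i) η : Fin (k + 1) → ℝ) j) ≤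
      B * ∏ i : Fin k, h i.succ (η i) := by
    intro η
    rw [Fin.prod_univ_succ]
    simp only [Fin.cons_zero, Fin.cons_succ]
    exact mul_le_mul_of_nonneg_right (hB _) (Finset.prod_nonneg fun i _ ↦ h0 _ _)
  have hI : Integrable (fun η : Fin k → ℝ ↦ B * ∏ i : Fin k, h i.succ (η i)) := by
    have := Integrable.fintype_prod (μ := fun _ : Fin k ↦ (volume : Measure ℝ)) (f := fun i ↦ h i.succ) hint
    exact this.const_mul B
  calc ∫ η : Fin k → ℝ, ∏ j, h j ((Fin.cons (-∑ i, η i) η : Fin (k + 1) → ℝ) j)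
      ≤ ∫ η : Fin k → ℝ, B * ∏ i : Fin k, h i.succ (η i) :=
        integral_mono_of_nonneg (Eventually.of_forall fun η ↦ Finset.prod_nonneg fun j _ ↦ h0 _ _) hI
          (Eventually.of_forall hpt)
    _ = B * ∏ i : Fin k, ∫ x, h i.succ x := by
        rw [integral_const_mul]
        congr 1
        exact integral_fintype_prod_volume_eq_prod (fun i ↦ h (Fin.succ i))

/-! ## One-dimensional integrals of the factors -/

/-- `∫ g₀(L|x|) dx = κ(0)/L` for `L > 0` (`g₀` even, `∫ g₀ = κ(0)`). [folklore] -/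
theorem integral_g0_re_mul_abs {L : ℝ} (hL : 0 < L) : ∫ x : ℝ, (g0 (L * |x|)).re = ker 0 / L := by
  have h1 : ∀ x : ℝ, (g0 (L * |x|)).re = (g0 (L * x)).re := by
    intro x
    rcases le_or_gt 0 x with hx | hx
    · rw [abs_of_nonneg hx]
    · rw [abs_of_neg hx, mul_neg, g0_neg]
  simp_rw [h1]
  rw [integral_comp_mul_left (fun y ↦ (g0 y).re) L, abs_of_pos (inv_pos.2 hL), smul_eq_mul]
  have h2 : ∫ y : ℝ, (g0 y).re = ker 0 := by
    have := congrArg Complex.re ker_zero_eq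
    rw [Complex.ofReal_re, re_integral_eq integrable_g0] at this
    exact this.symm
  rw [h2, div_eq_inv_mul]

/-- `x ↦ g₀(c − L|x|)` is continuous with compact support, hence integrable (`L > 0`). [folklore] -/
theorem integrable_g0_re_sub_mul_abs {L : ℝ} (hL : 0 < L) (c : ℝ) :
    Integrable fun x : ℝ ↦ (g0 (c - L * |x|)).re := by
  have hc : Continuous fun x : ℝ ↦ (g0 (c - L * |x|)).re :=
    Complex.continuous_re.comp (continuous_g0.comp (by fun_prop))
  refine hc.integrable_of_hasCompactSupport ?_
  refine HasCompactSupport.intro (isCompact_Icc (a := -((|c| + 1 / 4) / L)) (b := (|c| + 1 / 4) / L))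
    fun x hx ↦ ?_
  rw [Set.mem_Icc, not_and_or, not_le, not_le] at hx
  have hxL : (|c| + 1 / 4) / L < |x| := by
    rcases hx with hx | hx
    · have h0 : 0 ≤ (|c| + 1 / 4) / L := by positivity
      rw [abs_of_neg (a := x) (by linarith)]; linarith
    · exact lt_of_lt_of_le hx (le_abs_self x)
  have h1 : |c| + 1 / 4 < L * |x| := by rwa [div_lt_iff₀ hL, mul_comm] at hxL
  have : g0 (c - L * |x|) = 0 := g0_eq_zero (by
    have := abs_sub_abs_le_abs_sub (L * |x|) c
    rw [abs_sub_comm] at this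
    rw [abs_of_nonneg (by positivity : 0 ≤ L * |x|)] at this
    linarith [le_abs_self c, neg_abs_le c])
  simp [this]

/-- `x ↦ g₀(L|x|)` is integrable (`L > 0`). [folklore] -/
theorem integrable_g0_re_mul_abs {L : ℝ} (hL : 0 < L) : Integrable fun x : ℝ ↦ (g0 (L * |x|)).re := by
  have h := integrable_g0_re_sub_mul_abs hL 0
  refine h.congr (Eventually.of_forall fun x ↦ ?_)
  simp only [zero_sub, g0_neg]

/-- `∫ g₀(c − L|x|) dx ≤ 2κ(0)/L` for `L > 0` (`g₀(c − |u|) ≤ g₀(c − u) + g₀(c + u)`). [folklore] -/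
theorem integral_g0_re_sub_mul_abs_le {L : ℝ} (hL : 0 < L) (c : ℝ) :
    ∫ x : ℝ, (g0 (c - L * |x|)).re ≤ 2 * ker 0 / L := by
  have hk0 : ∫ y : ℝ, (g0 y).re = ker 0 := by
    have := congrArg Complex.re ker_zero_eq
    rw [Complex.ofReal_re, re_integral_eq integrable_g0] at this
    exact this.symm
  have hA : ∫ x : ℝ, (g0 (c - L * x)).re = ker 0 / L := by
    have e : (fun x : ℝ ↦ (g0 (c - L * x)).re) = fun x ↦ (fun y ↦ (g0 (c - y)).re) (L * x) := rfl
    rw [e, integral_comp_mul_left (fun y ↦ (g0 (c - y)).re) L, abs_of_pos (inv_pos.2 hL), smul_eq_mul,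
      integral_sub_left_eq_self (fun y ↦ (g0 y).re)]
    · rw [hk0, div_eq_inv_mul]
  have hB : ∫ x : ℝ, (g0 (c + L * x)).re = ker 0 / L := by
    have e : (fun x : ℝ ↦ (g0 (c + L * x)).re) = fun x ↦ (fun y ↦ (g0 (c + y)).re) (L * x) := rfl
    rw [e, integral_comp_mul_left (fun y ↦ (g0 (c + y)).re) L, abs_of_pos (inv_pos.2 hL), smul_eq_mul]
    have h := integral_add_left_eq_self (μ := (volume : Measure ℝ)) (fun y ↦ (g0 y).re) c
    rw [h, hk0, div_eq_inv_mul]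
  have hiA : Integrable fun x : ℝ ↦ (g0 (c - L * x)).re := by
    have : Integrable fun y : ℝ ↦ (g0 (c - y)).re := (integrable_g0.re).comp_sub_left c
    exact this.comp_mul_left' hL.ne'
  have hiB : Integrable fun x : ℝ ↦ (g0 (c + L * x)).re := by
    have : Integrable fun y : ℝ ↦ (g0 (c + y)).re := by
      have := (integrable_g0.re).comp_add_left c
      simpa [add_comm] using this
    exact this.comp_mul_left' hL.ne'
  have hpt : ∀ x : ℝ, (g0 (c - L * |x|)).re ≤ (g0 (c - L * x)).re + (g0 (c + L * x)).re := by
    intro x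
    rcases le_or_gt 0 x with hx | hx
    · rw [abs_of_nonneg hx]; linarith [g0_re_nonneg (c + L * x)]
    · rw [abs_of_neg hx, mul_neg, sub_neg_eq_add]; linarith [g0_re_nonneg (c - L * x)]
  calc ∫ x : ℝ, (g0 (c - L * |x|)).re ≤ ∫ x : ℝ, ((g0 (c - L * x)).re + (g0 (c + L * x)).re) :=
        integral_mono_of_nonneg (Eventually.of_forall fun x ↦ g0_re_nonneg _) (hiA.add hiB) (Eventually.of_forall hpt)
    _ = ker 0 / L + ker 0 / L := by rw [integral_add hiA hiB, hA, hB]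
    _ = 2 * ker 0 / L := by ring

/-- Equality case: for `c ≥ 1/4`, `∫ g₀(c − L|x|) dx = 2κ(0)/L` (`g₀(c + |u|) = 0`). [folklore] -/
theorem integral_g0_re_sub_mul_abs_eq {L : ℝ} (hL : 0 < L) {c : ℝ} (hc : 1 / 4 ≤ c) :
    ∫ x : ℝ, (g0 (c - L * |x|)).re = 2 * ker 0 / L := by
  have hk0 : ∫ y : ℝ, (g0 y).re = ker 0 := by
    have := congrArg Complex.re ker_zero_eq
    rw [Complex.ofReal_re, re_integral_eq integrable_g0] at this
    exact this.symm
  -- `g0 (c - L|x|) = g0 (c - L x) + g0 (c + L x)` pointwise: the extra term vanishes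
  have hpt : ∀ x : ℝ, (g0 (c - L * |x|)).re = (g0 (c - L * x)).re + (g0 (c + L * x)).re := by
    intro x
    rcases le_or_gt 0 x with hx | hx
    · rw [abs_of_nonneg hx, g0_eq_zero (v := c + L * x), Complex.zero_re, add_zero]
      rw [abs_of_nonneg (by nlinarith)]; nlinarith
    · rw [abs_of_neg hx, mul_neg, sub_neg_eq_add, g0_eq_zero (v := c - L * x), Complex.zero_re, zero_add]
      rw [abs_of_nonneg (by nlinarith)]; nlinarith
  have hiA : Integrable fun x : ℝ ↦ (g0 (c - L * x)).re := by
    have : Integrable fun y : ℝ ↦ (g0 (c - y)).re := (integrable_g0.re).comp_sub_left c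
    exact this.comp_mul_left' hL.ne'
  have hiB : Integrable fun x : ℝ ↦ (g0 (c + L * x)).re := by
    have : Integrable fun y : ℝ ↦ (g0 (c + y)).re := by
      have := (integrable_g0.re).comp_add_left c
      simpa [add_comm] using this
    exact this.comp_mul_left' hL.ne'
  have hA : ∫ x : ℝ, (g0 (c - L * x)).re = ker 0 / L := by
    have e : (fun x : ℝ ↦ (g0 (c - L * x)).re) = fun x ↦ (fun y ↦ (g0 (c - y)).re) (L * x) := rfl
    rw [e, integral_comp_mul_left (fun y ↦ (g0 (c - y)).re) L, abs_of_pos (inv_pos.2 hL), smul_eq_mul,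
      integral_sub_left_eq_self (fun y ↦ (g0 y).re)]
    rw [hk0, div_eq_inv_mul]
  have hB : ∫ x : ℝ, (g0 (c + L * x)).re = ker 0 / L := by
    have e : (fun x : ℝ ↦ (g0 (c + L * x)).re) = fun x ↦ (fun y ↦ (g0 (c + y)).re) (L * x) := rfl
    rw [e, integral_comp_mul_left (fun y ↦ (g0 (c + y)).re) L, abs_of_pos (inv_pos.2 hL), smul_eq_mul]
    have h := integral_add_left_eq_self (μ := (volume : Measure ℝ)) (fun y ↦ (g0 y).re) c
    rw [h, hk0, div_eq_inv_mul]
  simp_rw [hpt]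
  rw [integral_add hiA hiB, hA, hB]
  ring

/-- The coefficient of one slot as a function of the coordinate: `c_{L|x|}(ν) = Λ(ν)/√ν · g₀(log ν − L|x|)`,
and `∫ c_{L|x|}(ν) dx ≤ 2κ(0) Λ(ν)/(L √ν)`. [cite: RudnickSarnak1996, (3.36)] -/
theorem integral_coefR_mul_abs_le {L : ℝ} (hL : 0 < L) (ν : ℕ) :
    ∫ x : ℝ, coefR (L * |x|) ν ≤ 2 * ker 0 / L * (Λ ν / Real.sqrt ν) := by
  unfold coefR
  rw [integral_const_mul, mul_comm]
  refine mul_le_mul_of_nonneg_right ?_ (div_nonneg ArithmeticFunction.vonMangoldt_nonneg (Real.sqrt_nonneg _))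
  have := integral_g0_re_sub_mul_abs_le hL (Real.log ν)
  simpa [sub_eq_add_neg] using this

/-- Equality case: for `ν ≥ 2`, `∫ c_{L|x|}(ν) dx = 2κ(0) Λ(ν)/(L √ν)`. [cite: RudnickSarnak1996, (3.36)] -/
theorem integral_coefR_mul_abs_eq {L : ℝ} (hL : 0 < L) {ν : ℕ} (hν : 2 ≤ ν) :
    ∫ x : ℝ, coefR (L * |x|) ν = 2 * ker 0 / L * (Λ ν / Real.sqrt ν) := by
  unfold coefR
  rw [integral_const_mul, mul_comm]
  congr 1
  have hc : (1 / 4 : ℝ) ≤ Real.log ν := by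
    have := Real.log_le_log (by norm_num) (show (2 : ℝ) ≤ ν by exact_mod_cast hν)
    linarith [quarter_lt_log_two]
  exact integral_g0_re_sub_mul_abs_eq hL hc

/-- `x ↦ c_{L|x|}(ν)` is integrable. [folklore] -/
theorem integrable_coefR_mul_abs {L : ℝ} (hL : 0 < L) (ν : ℕ) : Integrable fun x : ℝ ↦ coefR (L * |x|) ν := by
  unfold coefR
  exact (integrable_g0_re_sub_mul_abs hL (Real.log ν)).const_mul _

/-- Truncation: on `|x| ≤ 2`, `c_{L|x|}(ν) = 0` for `ν > N_{2L}` (`N_a = ⌊e^{a+1/4}⌋` is monotone in `a`).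
[folklore] -/
theorem coefR_mul_abs_eq_zero_of_lt {L x : ℝ} (hL : 0 ≤ L) (hx : |x| ≤ 2) {ν : ℕ} (hν : suppBound (2 * L) < ν) :
    coefR (L * |x|) ν = 0 := by
  refine coefR_eq_zero_of_exp_le ?_
  have h1 := (Nat.floor_lt (Real.exp_pos _).le).1 hν
  refine le_trans (Real.exp_le_exp.2 ?_) h1.le
  nlinarith [abs_nonneg x]

end RudnickSarnakN

end Literature.NumberTheory.LFunctions

end
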